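import Summits.HodgeConjecture.HodgeConjecture.Theorems.SixfoldTableXCensusQuarticGeneralRow
import Literature.AlgebraicGeometry.HodgeTheory.CMFieldHodgeGroupPowersHodgeClasses
import HarnessLib

/-!
# TABLE X (dimension 6) — row 12 `g6.IV(3,1).generic` (`End⁰ = F` a SEXTIC CM field, `dim_F H¹ = 2`), the GENERAL MEMBER
# (`Hg = U_F`, Lie form `hU` DISPLAYED), and the CM-FIELD CENTRE OF ANY DEGREE: the census nodes X2 / X1 DISCHARGED IN THE
# KERNEL on the whole isogeny class, from the tree theorem `AbelianVariety.isDivisorGenerated_of_hodgeLieC_cmField`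
# (MZ99 (1.8) ⟹ for `D = E` a CM field, Hazama / Murty) (cell `pub-hodgeav-hg6`, req-37 (A) Q2b; eng-4 g5, lead g2 GO 22:13:02Z)

HONEST FRAMING. HC, `HC_AV` (stmt-1333), `HC_CM` (stmt-3052) and the rung H2 are NOT proved and do not occur here. The
census nodes `TableX.SixfoldCodimTwoCensus` (X2) / `TableX.SixfoldCodimThreeCensus` (X1) of `SixfoldTableXCover` are OURS
(`@[conjecture]`), never asserted. KERNEL ONLY: theorems over existing declarations; no definition, no `sorry`, no named
fact; typed ≠ proved. **General member only: hU is the Lie form of Hg = U_F (MZ99 Table 1 row IV(3,1) ‘general’); the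
special members (Hg ⊊ U_F) are NOT covered; HC ∕ HC_AV NOT proved.**

WHY THIS MODULE (census-node self-audit, axis A7, continued). The A7 inventory (HOME/jobs/A7-inventory-eng4g4 §1 row 12)
recorded row 12 as «NOT on A7. Missing: “Hg = U_F (patterns P51∕P42) ⟹ B = D” (7 GAP engines ×2, no kernel)». The
Literature lane now holds the coloured multiplicity-free socket for an ARBITRARY finite colour type `ι` (this cell's G2/G3:
`CMHodgeGroupSlotsHodgeClasses`, `CMHodgeGroupDualBases`, `CMHodgeGroupPowersHodgeClasses`, `CMHodgeGroupCrossedClasses`) and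
its geometric end `AbelianVariety.isDivisorGenerated_of_hodgeLieC_cmField` (`CMFieldHodgeGroupPowersHodgeClasses`): for
`finrank_ℚ End⁰(B) = 2|ι|`, `φ ∈ End(B)` with colours `μ : ι → ℂ` (injective, no `μ k'` conjugate to a `μ k` — the `2|ι|`
eigenvalues `μ k`, `conj μ k` of `φ^*` pairwise distinct), `eigenMultiplicity B φ (μ k) + eigenMultiplicity B φ (conj μ k) =
n₀` for every `k`, `0 < n₀`, `dim B = |ι| n₀`, a polarization `ψ` of `H¹(B(ℂ); ℚ)` and
  `hU`: every `(φ^*)_ℂ`-commuting `ψ_ℂ`-skew operator of `H¹(B(ℂ); ℂ)` lies in `Lie Hg(H¹(B)) ⊗ ℂ`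
(`Lie Hg ⊗ ℂ = 𝔲_E ⊗ ℂ ≅ ∏_k 𝔤𝔩(W_{μ k})`, i.e. `Hg(B) = U_E(V,ψ)`), `B = D` holds on `B` and on every abelian variety with
slots over `B`. THIS FILE feeds it into L10's entry point `SimpleRows.census_of_isIsogenous_of_isDivisorGenerated`, with
`hU` carried VERBATIM (spelled as in L13 / the row-10 module):
* §1 `census_of_isIsogenous_cmFieldGeneral` (ANY `ι`, any `n₀`, any dimension), `hodgeConjectureFor_of_isIsogenous_cmFieldGeneral`
  (L6's conclusion on the isogeny class under `hU`; on `B` and its powers it is the tree's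
  `hodgeConjectureFor_powSucc_of_hodgeLieC_cmField` BY NAME). For `ι = Fin 1` this is the general member of row 8
  (L13, where it is stated in the imaginary quadratic vocabulary), for `ι = Fin 2` row 10 (`SixfoldTableXCensusQuarticGeneralRow`).
* §2 `census_row12_sexticGeneral` — TABLE X row 12, GENERAL MEMBER, KERNEL VERDICT under `hU` (`ι = Fin 3`, `n₀ = 2`,
  `dim B = 6`, `finrank_ℚ End⁰(B) = 6`, `B` simple): every `A ∼ B` is IN THE NODES' DOMAIN `dim A = 6 ∧ ¬ 𝒞 A` (hU-free: `B`
  simple by hypothesis and not of CM type since `dim_ℚ End⁰(B) = 6 < 12`) AND satisfies X2-at-`A` ∧ X1-at-`A`;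
  `census_row12_sexticGeneral_self`.

READING (honest scope). The signature of `F` on `H^{1,0}` is not fixed (`hmult` only asks `n_σ + n_σ̄ = 2` per pair of
places: patterns `(2,0;1,1;1,1)`, `(1,1;1,1;1,1)`, …); `hU` does the work and holds for the GENERAL member of row 12 (MZ99
Table 1); members with `Hg ⊊ U_F` (row 13: `F ∋ k` acting `(3,3)`, Weil carrier — `hU` fails; CM members — outside the
domain) are NOT covered. Without simplicity the same data describe products of pairwise non-isogenous type IV factors
with distinct imaginary quadratic / quartic centres (row 28 members); §2 asks `B` simple, which is row 12. No inhabitant is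
exhibited and none is invented here.

All declarations live in the sub-namespace `TableX.TypeIVRows` (lead g2 DEDUP RULE: import the entry points, restate
nothing). Nothing here is a corollary of `HC_CM`; no hypothesis of the cover is discharged GLOBALLY (X2 / X1 quantify over
ALL off-residue sixfolds and stay `@[conjecture]`); typed ≠ proved.
-/

set_option linter.dupNamespace false

noncomputable section

open scoped TensorProduct
open CategoryTheory
open Literature.AlgebraicGeometry Literature.AlgebraicGeometry.Motives
open Literature.AlgebraicGeometry.Motives.AbelianVariety (IsIsogenous IsSimple)
open Literature.AlgebraicGeometry.HodgeTheory
open Literature.AlgebraicGeometry.Milne1999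
open Literature.AlgebraicTopology.SingularHomology
open Literature.Barriers.HodgeConjecture
open Summit.HodgeConjecture.HodgeConjecture.Ring2.ClassTargets
open Summit.HodgeConjecture.HodgeConjecture.Ring2.Motiv (ProdCMCell)
open Summit.HodgeConjecture.HodgeConjecture.Ring2.Atlas (IsQuarticFieldTypeIVFourfold)
open Summit.HodgeConjecture.HodgeConjecture.TableX.SimpleRows

namespace Summit.HodgeConjecture.HodgeConjecture.TableX.TypeIVRows

/-! ## §1 CM-field centre of any degree with `Hg = U_E` (Lie form `hU`): both census conclusions on the isogeny class -/

/-- **Both census conclusions X2-at-`A`, X1-at-`A` at every `A` isogenous to a complex abelian variety `B` with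
`End⁰(B) = ℚ(φ)` commutative of degree `2|ι|` (colours `μ : ι → ℂ`, pair multiplicities `n₀`, `dim B = |ι| n₀`) and
`Hg(B) = U_E` in the Lie form `hU`** — ANY finite colour type `ι`: `B = D` on `B` is the tree's
`AbelianVariety.isDivisorGenerated_of_hodgeLieC_cmField` (MZ99 (1.8) ⟹ for `D = E`: «`Hg(X) = Sp_D(V,φ)` ⟹ `D(Xⁿ) = B(Xⁿ)`
for all `n`», Hazama / Murty), transported by L10's `census_of_isIsogenous_of_isDivisorGenerated`. General member only: hU is
the Lie form of Hg = U_E; the special members (Hg ⊊ U_E) are NOT covered; HC ∕ HC_AV NOT proved.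
[cite: MoonenZarhin1999LowDim, §1 (1.8), §2 (2.3) and §5 (5.1)] [cite: Milne1999LefschetzClasses, Prop. 3.6 (c)]
[cite: vanGeemen1994HodgeAV, §2.4–2.5 and Lemma 3.7] -/
theorem census_of_isIsogenous_cmFieldGeneral {ι : Type} [Fintype ι] [DecidableEq ι] {A B : AbelianVariety ℂ}
    (φ : B ⟶ B)
    (hE : Module.finrank ℚ B.endAlgebra = 2 * Fintype.card ι) (μ : ι → ℂ) (hinj : Function.Injective μ)
    (hdist : ∀ k k', μ k' ≠ starRingEnd ℂ (μ k)) {n₀ : ℕ} (hn₀ : 0 < n₀)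
    (hmult : ∀ k, eigenMultiplicity B φ (μ k) + eigenMultiplicity B φ (starRingEnd ℂ (μ k)) = n₀)
    (hdim : B.dim = Fintype.card ι * n₀)
    (hHD : exists_isReal_hodgeModel) (hI : hodgePQ_independent_of_hodgeModel)
    (ψ : (BettiUniverse.hodge hHD (AbelianVariety.isSmoothProjective_holds (A := B)) 1).Polarization)
    (hU : haveI : HodgeTensorFacts.{0, 0} := hodgeTensorFacts_holds
      ∀ Y : Module.End ℂ (ℂ ⊗[ℚ] bettiCohomology B.X 1),
        Y * ((bettiCohomology.map φ.hom.hom.hom 1).hom).baseChange ℂ =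
            ((bettiCohomology.map φ.hom.hom.hom 1).hom).baseChange ℂ * Y →
          (∀ x y, ψ.form.baseChange ℂ (Y x) y + ψ.form.baseChange ℂ x (Y y) = 0) →
            Y ∈ (BettiUniverse.hodge hHD (AbelianVariety.isSmoothProjective_holds (A := B)) 1).hodgeLieC)
    (hAB : IsIsogenous A B) :
    (∀ c : complexBetti A.X (2 * 2), IsRationalClass c → IsOfHodgeType A.dim A.X (2 * 2) 2 2 c →
      c ∈ divisorClassesSpan A.X A.dim 2 ⊔ Submodule.span ℂ {w' : complexBetti A.X (2 * 2) |
        ∃ (C : AbelianVariety ℂ) (g : A.X ⟶ C.X) (w : complexBetti C.X (2 * 2)), C.dim < A.dim ∧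
          IsRationalClass w ∧ IsOfHodgeType C.dim C.X (2 * 2) 2 2 w ∧ w' = complexBetti.map g (2 * 2) w}) ∧
    (∀ c : complexBetti A.X (2 * 3), IsRationalClass c → IsOfHodgeType A.dim A.X (2 * 3) 3 3 c →
      c ∈ divisorClassesSpan A.X A.dim 3 ⊔ Submodule.span ℂ {w' : complexBetti A.X (2 * 3) |
          ∃ (a : complexBetti A.X (2 * 2)) (b : complexBetti A.X (2 * 1)),
            IsRationalClass a ∧ IsOfHodgeType A.dim A.X (2 * 2) 2 2 a ∧ IsRationalClass b ∧
            IsOfHodgeType A.dim A.X (2 * 1) 1 1 b ∧ w' = cupProduct (two_mul_add_two_mul 2 1) a b} ⊔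
        Submodule.span ℂ {w' : complexBetti A.X (2 * 3) |
          ∃ (C : AbelianVariety ℂ) (g : A.X ⟶ C.X) (w : complexBetti C.X (2 * 3)), C.dim < A.dim ∧
            IsRationalClass w ∧ IsOfHodgeType C.dim C.X (2 * 3) 3 3 w ∧ w' = complexBetti.map g (2 * 3) w} ⊔
        Submodule.span ℂ {w' : complexBetti A.X (2 * 3) |
          ∃ (B' : AbelianVariety ℂ) (g : A.X ⟶ B'.X) (d : ℕ) (ψ : B' ⟶ B') (w : complexBetti B'.X (2 * 3)),
            B'.dim = 6 ∧ 0 < d ∧ ψ ≫ ψ = -(d • 𝟙 B') ∧ IsRationalClass w ∧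
            IsOfHodgeType B'.dim B'.X (2 * 3) 3 3 w ∧ w ∈ weilClassesOf B' ψ 3 d ∧
            w' = complexBetti.map g (2 * 3) w}) :=
  haveI : HodgeTensorFacts.{0, 0} := hodgeTensorFacts_holds
  census_of_isIsogenous_of_isDivisorGenerated hAB
    (AbelianVariety.isDivisorGenerated_of_hodgeLieC_cmField B φ hE μ hinj hdist hn₀ hmult hdim hHD hI ψ hU)

/-- **L6's CONCLUSION on the isogeny class under `hU`: the Hodge conjecture holds for every complex abelian variety
isogenous to a `B` with CM-field centre `ℚ(φ)` of any degree and `Hg(B) = U_E`** (`B = D` on the model, transported by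
`hodgeConjectureFor_of_isIsogenous_of_isDivisorGenerated`; on `B` and its powers this is the tree's
`hodgeConjectureFor_powSucc_of_hodgeLieC_cmField` by name). None of Markman₄ / Markman₆ / R-W6 / X2 / X1 / `HC_CM` enters;
`hU` is displayed, never discharged. General member only: hU is the Lie form of Hg = U_E; the special members (Hg ⊊ U_E)
are NOT covered; HC ∕ HC_AV NOT proved. [cite: MoonenZarhin1999LowDim, §1 (1.7)–(1.8)] [cite: vanGeemen1994HodgeAV, §2.4 and Lemma 3.7] -/
theorem hodgeConjectureFor_of_isIsogenous_cmFieldGeneral {ι : Type} [Fintype ι] [DecidableEq ι]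
    {A B : AbelianVariety ℂ} (φ : B ⟶ B)
    (hE : Module.finrank ℚ B.endAlgebra = 2 * Fintype.card ι) (μ : ι → ℂ) (hinj : Function.Injective μ)
    (hdist : ∀ k k', μ k' ≠ starRingEnd ℂ (μ k)) {n₀ : ℕ} (hn₀ : 0 < n₀)
    (hmult : ∀ k, eigenMultiplicity B φ (μ k) + eigenMultiplicity B φ (starRingEnd ℂ (μ k)) = n₀)
    (hdim : B.dim = Fintype.card ι * n₀)
    (hHD : exists_isReal_hodgeModel) (hI : hodgePQ_independent_of_hodgeModel)
    (ψ : (BettiUniverse.hodge hHD (AbelianVariety.isSmoothProjective_holds (A := B)) 1).Polarization)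
    (hU : haveI : HodgeTensorFacts.{0, 0} := hodgeTensorFacts_holds
      ∀ Y : Module.End ℂ (ℂ ⊗[ℚ] bettiCohomology B.X 1),
        Y * ((bettiCohomology.map φ.hom.hom.hom 1).hom).baseChange ℂ =
            ((bettiCohomology.map φ.hom.hom.hom 1).hom).baseChange ℂ * Y →
          (∀ x y, ψ.form.baseChange ℂ (Y x) y + ψ.form.baseChange ℂ x (Y y) = 0) →
            Y ∈ (BettiUniverse.hodge hHD (AbelianVariety.isSmoothProjective_holds (A := B)) 1).hodgeLieC)
    (hAB : IsIsogenous A B) : HodgeConjectureFor A.dim A.X :=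
  haveI : HodgeTensorFacts.{0, 0} := hodgeTensorFacts_holds
  hodgeConjectureFor_of_isIsogenous_of_isDivisorGenerated hAB
    (AbelianVariety.isDivisorGenerated_of_hodgeLieC_cmField B φ hE μ hinj hdist hn₀ hmult hdim hHD hI ψ hU)

/-! ## §2 TABLE X row 12 `g6.IV(3,1).generic`, GENERAL MEMBER (`Hg = U_F`, `F` sextic CM): kernel verdict with domain membership -/

/-- **TABLE X ROW 12 `g6.IV(3,1).generic`, GENERAL MEMBER — KERNEL VERDICT on the whole isogeny class under `hU`.** For a
SIMPLE complex abelian SIXFOLD `B` with `finrank_ℚ End⁰(B) = 6` and `φ ∈ End(B)` with colours `μ : Fin 3 → ℂ` (injective,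
no `μ k'` conjugate to a `μ k`: the six eigenvalues `μ k`, `conj μ k` of `φ^*` on `H¹(B)` pairwise distinct) and
`eigenMultiplicity B φ (μ k) + eigenMultiplicity B φ (conj μ k) = 2` for every `k` — so `F = End⁰(B) = ℚ(φ)` is a sextic CM
field with `dim_F H¹(B;ℚ) = 2` —, a polarization `ψ` of `H¹(B(ℂ); ℚ)` and `Hg(B) = U_F(V,ψ)` in the Lie form `hU`, and for
every `A` isogenous to `B`: `dim A = 6` and `A` is OFF the residue class `𝒞` (hU-free: `B` simple, and not of CM type since
`dim_ℚ End⁰(B) = 6 < 12`), AND both census conclusions X2-at-`A`, X1-at-`A` hold (§1 at `ι = Fin 3`, `n₀ = 2`). General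
member only: hU is the Lie form of Hg = U_F (MZ99 Table 1 row IV(3,1) ‘general’); the special members (Hg ⊊ U_F) are NOT
covered; HC ∕ HC_AV NOT proved. [cite: MoonenZarhin1999LowDim, §1 (1.8), §2 (2.3) and §5 (5.1)]
[cite: vanGeemen1994HodgeAV, Lemma 3.7] [cite: MumfordAV1970, §19 Cor. 2 of Thm. 1 (p. 174)] [cite: Milne1999, §2 p. 54] -/
theorem census_row12_sexticGeneral {A B : AbelianVariety ℂ} (hB : B.dim = 6) (hBs : B.IsSimple) (φ : B ⟶ B)
    (hE6 : Module.finrank ℚ B.endAlgebra = 6) (μ : Fin 3 → ℂ) (hinj : Function.Injective μ)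
    (hdist : ∀ k k', μ k' ≠ starRingEnd ℂ (μ k))
    (hmult : ∀ k, eigenMultiplicity B φ (μ k) + eigenMultiplicity B φ (starRingEnd ℂ (μ k)) = 2)
    (hHD : exists_isReal_hodgeModel) (hI : hodgePQ_independent_of_hodgeModel)
    (ψ : (BettiUniverse.hodge hHD (AbelianVariety.isSmoothProjective_holds (A := B)) 1).Polarization)
    (hU : haveI : HodgeTensorFacts.{0, 0} := hodgeTensorFacts_holds
      ∀ Y : Module.End ℂ (ℂ ⊗[ℚ] bettiCohomology B.X 1),
        Y * ((bettiCohomology.map φ.hom.hom.hom 1).hom).baseChange ℂ =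
            ((bettiCohomology.map φ.hom.hom.hom 1).hom).baseChange ℂ * Y →
          (∀ x y, ψ.form.baseChange ℂ (Y x) y + ψ.form.baseChange ℂ x (Y y) = 0) →
            Y ∈ (BettiUniverse.hodge hHD (AbelianVariety.isSmoothProjective_holds (A := B)) 1).hodgeLieC)
    (hAB : IsIsogenous A B) :
    (A.dim = 6 ∧ ¬ (IsOfCMType A ∨ ProdCMCell IsQuarticFieldTypeIVFourfold (fun Z ↦ Z.dim = 2) A)) ∧
    (∀ c : complexBetti A.X (2 * 2), IsRationalClass c → IsOfHodgeType A.dim A.X (2 * 2) 2 2 c →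
      c ∈ divisorClassesSpan A.X A.dim 2 ⊔ Submodule.span ℂ {w' : complexBetti A.X (2 * 2) |
        ∃ (C : AbelianVariety ℂ) (g : A.X ⟶ C.X) (w : complexBetti C.X (2 * 2)), C.dim < A.dim ∧
          IsRationalClass w ∧ IsOfHodgeType C.dim C.X (2 * 2) 2 2 w ∧ w' = complexBetti.map g (2 * 2) w}) ∧
    (∀ c : complexBetti A.X (2 * 3), IsRationalClass c → IsOfHodgeType A.dim A.X (2 * 3) 3 3 c →
      c ∈ divisorClassesSpan A.X A.dim 3 ⊔ Submodule.span ℂ {w' : complexBetti A.X (2 * 3) |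
          ∃ (a : complexBetti A.X (2 * 2)) (b : complexBetti A.X (2 * 1)),
            IsRationalClass a ∧ IsOfHodgeType A.dim A.X (2 * 2) 2 2 a ∧ IsRationalClass b ∧
            IsOfHodgeType A.dim A.X (2 * 1) 1 1 b ∧ w' = cupProduct (two_mul_add_two_mul 2 1) a b} ⊔
        Submodule.span ℂ {w' : complexBetti A.X (2 * 3) |
          ∃ (C : AbelianVariety ℂ) (g : A.X ⟶ C.X) (w : complexBetti C.X (2 * 3)), C.dim < A.dim ∧
            IsRationalClass w ∧ IsOfHodgeType C.dim C.X (2 * 3) 3 3 w ∧ w' = complexBetti.map g (2 * 3) w} ⊔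
        Submodule.span ℂ {w' : complexBetti A.X (2 * 3) |
          ∃ (B' : AbelianVariety ℂ) (g : A.X ⟶ B'.X) (d : ℕ) (ψ : B' ⟶ B') (w : complexBetti B'.X (2 * 3)),
            B'.dim = 6 ∧ 0 < d ∧ ψ ≫ ψ = -(d • 𝟙 B') ∧ IsRationalClass w ∧
            IsOfHodgeType B'.dim B'.X (2 * 3) 3 3 w ∧ w ∈ weilClassesOf B' ψ 3 d ∧
            w' = complexBetti.map g (2 * 3) w}) :=
  ⟨offResidueSix_of_isIsogenous_of_isSimple_of_not_isOfCMType hAB hB hBs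
      (not_isOfCMType_of_finrank_endAlgebra_lt_two_mul_dim (by omega)),
    census_of_isIsogenous_cmFieldGeneral φ (by rw [hE6, Fintype.card_fin]) μ hinj hdist (by norm_num) hmult
      (by rw [hB, Fintype.card_fin]) hHD hI ψ hU hAB⟩

/-- **Row 12, general member, the model itself**: `B` is in the nodes' domain and satisfies X2-at-`B` ∧ X1-at-`B` under
`hU` (the case `A = B` of `census_row12_sexticGeneral`). General member only: hU is the Lie form of Hg = U_F; the special
members (Hg ⊊ U_F) are NOT covered; HC ∕ HC_AV NOT proved. [cite: MoonenZarhin1999LowDim, §1 (1.8) and §2 (2.3)] -/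
theorem census_row12_sexticGeneral_self {B : AbelianVariety ℂ} (hB : B.dim = 6) (hBs : B.IsSimple) (φ : B ⟶ B)
    (hE6 : Module.finrank ℚ B.endAlgebra = 6) (μ : Fin 3 → ℂ) (hinj : Function.Injective μ)
    (hdist : ∀ k k', μ k' ≠ starRingEnd ℂ (μ k))
    (hmult : ∀ k, eigenMultiplicity B φ (μ k) + eigenMultiplicity B φ (starRingEnd ℂ (μ k)) = 2)
    (hHD : exists_isReal_hodgeModel) (hI : hodgePQ_independent_of_hodgeModel)
    (ψ : (BettiUniverse.hodge hHD (AbelianVariety.isSmoothProjective_holds (A := B)) 1).Polarization)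
    (hU : haveI : HodgeTensorFacts.{0, 0} := hodgeTensorFacts_holds
      ∀ Y : Module.End ℂ (ℂ ⊗[ℚ] bettiCohomology B.X 1),
        Y * ((bettiCohomology.map φ.hom.hom.hom 1).hom).baseChange ℂ =
            ((bettiCohomology.map φ.hom.hom.hom 1).hom).baseChange ℂ * Y →
          (∀ x y, ψ.form.baseChange ℂ (Y x) y + ψ.form.baseChange ℂ x (Y y) = 0) →
            Y ∈ (BettiUniverse.hodge hHD (AbelianVariety.isSmoothProjective_holds (A := B)) 1).hodgeLieC) :
    (B.dim = 6 ∧ ¬ (IsOfCMType B ∨ ProdCMCell IsQuarticFieldTypeIVFourfold (fun Z ↦ Z.dim = 2) B)) ∧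
    (∀ c : complexBetti B.X (2 * 2), IsRationalClass c → IsOfHodgeType B.dim B.X (2 * 2) 2 2 c →
      c ∈ divisorClassesSpan B.X B.dim 2 ⊔ Submodule.span ℂ {w' : complexBetti B.X (2 * 2) |
        ∃ (C : AbelianVariety ℂ) (g : B.X ⟶ C.X) (w : complexBetti C.X (2 * 2)), C.dim < B.dim ∧
          IsRationalClass w ∧ IsOfHodgeType C.dim C.X (2 * 2) 2 2 w ∧ w' = complexBetti.map g (2 * 2) w}) ∧
    (∀ c : complexBetti B.X (2 * 3), IsRationalClass c → IsOfHodgeType B.dim B.X (2 * 3) 3 3 c →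
      c ∈ divisorClassesSpan B.X B.dim 3 ⊔ Submodule.span ℂ {w' : complexBetti B.X (2 * 3) |
          ∃ (a : complexBetti B.X (2 * 2)) (b : complexBetti B.X (2 * 1)),
            IsRationalClass a ∧ IsOfHodgeType B.dim B.X (2 * 2) 2 2 a ∧ IsRationalClass b ∧
            IsOfHodgeType B.dim B.X (2 * 1) 1 1 b ∧ w' = cupProduct (two_mul_add_two_mul 2 1) a b} ⊔
        Submodule.span ℂ {w' : complexBetti B.X (2 * 3) |
          ∃ (C : AbelianVariety ℂ) (g : B.X ⟶ C.X) (w : complexBetti C.X (2 * 3)), C.dim < B.dim ∧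
            IsRationalClass w ∧ IsOfHodgeType C.dim C.X (2 * 3) 3 3 w ∧ w' = complexBetti.map g (2 * 3) w} ⊔
        Submodule.span ℂ {w' : complexBetti B.X (2 * 3) |
          ∃ (B' : AbelianVariety ℂ) (g : B.X ⟶ B'.X) (d : ℕ) (ψ : B' ⟶ B') (w : complexBetti B'.X (2 * 3)),
            B'.dim = 6 ∧ 0 < d ∧ ψ ≫ ψ = -(d • 𝟙 B') ∧ IsRationalClass w ∧
            IsOfHodgeType B'.dim B'.X (2 * 3) 3 3 w ∧ w ∈ weilClassesOf B' ψ 3 d ∧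
            w' = complexBetti.map g (2 * 3) w}) :=
  census_row12_sexticGeneral hB hBs φ hE6 μ hinj hdist hmult hHD hI ψ hU (IsIsogenous.refl B)

end Summit.HodgeConjecture.HodgeConjecture.TableX.TypeIVRows

end
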